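import Summits.KontsevichZagierPeriods.KontsevichZagierPeriods.Theorems.IsogenyCertificatesGenusTwoRealPeriodCellStubSubband
import Summits.KontsevichZagierPeriods.KontsevichZagierPeriods.Theorems.IsogenyCertificatesGenusTwoRealPeriodCellStubTelescope

/-!
# `GenusTwoRealPeriodCell` (stmt-KontsevichZagierPeriods-17657), line `Sketch`: the engine over ONE
# base cell (`stub_bandNLCell`)

Preliminaries: fibre lengths of measurable sets are measurable (`measurable_volume_fibre`, Tonelli);
a band of a cylindrical decomposition over a base set of positive measure has positive measure
(`volume_bandOver_ne_zero`); vertical lines in `ℝ²` are null (`volume_setOf_apply_zero_eq_or`). Then the heart of `stub_bandNewtonLeibniz` (Newton–Leibniz down the closed band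
`{a₀ ≤ x ≤ a₁, α x ≤ y ≤ β x}` with the bounded semialgebraic primitive `F`, off a null exceptional
set `Z`): over one cell `C ⊆ ℝ¹` of a cylindrical decomposition adapted to BOTH `U \ Z` and `U ∩ Z`
(`U` the open band), the piece of the band representation over `C` and the piece of the base
representation `[∫ F(x, β x) − F(x, α x) dx]` over `C` differ by relations:

* a cell of measure zero carries null pieces;
* over a cell of positive measure `Z` has no bands (a band has positive measure,
  `volume_bandOver_ne_zero`), the bands of `U \ Z` are inner (their fibres are bounded), the closed
  sub-bands cover the piece of the band up to graphs and two vertical lines (rule 1a,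
  `KZ.of_sub_sum_of_mem_relations`), each closed sub-band goes down by ONE Newton–Leibniz move
  (`stub_subband`), and the base integrands telescope to `F(x, β x) − F(x, α x)` (`stub_telescope`,
  rule 1b, `KZ.of_sub_sum_integrand_mem_relations`).

References: M. Kontsevich, D. Zagier, *Periods* (2001), §1.2 rules (1), (3); S. Basu, R. Pollack,
M.-F. Roy, *Algorithms in Real Algebraic Geometry* (2006), Cor. 5.7.
-/

noncomputable section

open scoped BigOperators Topology ENNReal
open Set MeasureTheory Filter
open Literature.NumberTheory.Transcendental
open Literature.ModelTheory.ExponentialFields (IsSemialgebraic graphOver bandOver bandLower bandUpper snoc_mem_bandOver_iff bandLower_of_ne_zero bandUpper_of_ne_last)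

namespace Summit.KontsevichZagierPeriods.IsogenyCertificates.GenusTwoRealPeriodCellLine

variable {m : ℕ}

/-- **Fibre lengths are measurable** (Tonelli): for a measurable `A ⊆ ℝᵐ⁺¹`, the length of the
last-coordinate fibre `{t | (x, t) ∈ A}` is a measurable function of `x`. [folklore] -/
theorem measurable_volume_fibre {A : Set (Fin (m + 1) → ℝ)} (hA : MeasurableSet A) :
    Measurable fun x : Fin m → ℝ => volume (FibreLength.fibre A x) := by
  set e : (Fin (m + 1) → ℝ) ≃ᵐ ℝ × (Fin m → ℝ) :=
    MeasurableEquiv.piFinSuccAbove (fun _ => ℝ) (Fin.last m) with he_def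
  have hsymm : ∀ p : ℝ × (Fin m → ℝ), e.symm p = Fin.snoc p.2 p.1 := fun p => by
    rw [he_def, MeasurableEquiv.piFinSuccAbove_symm_apply, Fin.insertNthEquiv_last]
    rfl
  have hS : MeasurableSet (e.symm ⁻¹' A) := e.symm.measurable hA
  have h := measurable_measure_prodMk_right (μ := (volume : Measure ℝ)) hS
  have hfun : (fun x : Fin m → ℝ => volume (FibreLength.fibre A x)) =
      fun y => volume ((fun t : ℝ => (t, y)) ⁻¹' (e.symm ⁻¹' A)) := by
    funext x
    congr 1
    ext t
    simp only [mem_preimage, hsymm, FibreLength.fibre, mem_setOf_eq]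
  rw [hfun]
  exact h

/-- The boundaries of every band satisfy `ξ_{j-1} < ξ_j` at a point where the sections increase
(with the conventions `ξ_{-1} = -∞`, `ξ_ℓ = +∞`). [cite: BasuPollackRoy2006, Def. 5.1] -/
theorem bandLower_lt_bandUpper {l : ℕ} (ξ : Fin l → (Fin m → ℝ) → ℝ) {x : Fin m → ℝ}
    (hmono : StrictMono fun i => ξ i x) (j : Fin (l + 1)) : bandLower ξ j x < bandUpper ξ j x := by
  by_cases h0 : j = 0
  · subst h0
    rw [Literature.ModelTheory.ExponentialFields.bandLower_zero]
    obtain ⟨c, hc⟩ := KZ.exists_coe_lt_bandUpper ξ 0 x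
    exact lt_trans (EReal.bot_lt_coe c) hc
  · by_cases hl : j = Fin.last l
    · subst hl
      rw [Literature.ModelTheory.ExponentialFields.bandUpper_last]
      obtain ⟨c, hc⟩ := KZ.exists_bandLower_lt_coe ξ (Fin.last l) x
      exact lt_trans hc (EReal.coe_lt_top c)
    · rw [Literature.ModelTheory.ExponentialFields.bandLower_of_ne_zero ξ j h0,
        Literature.ModelTheory.ExponentialFields.bandUpper_of_ne_last ξ j hl, EReal.coe_lt_coe_iff]
      exact hmono (Fin.pred_lt_castPred h0 hl)

/-- **A band over a base set of positive measure has positive measure**: its vertical fibres over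
the base are non-empty open subsets of `ℝ`, hence of positive length, and Cavalieri's principle
applies. [folklore] -/
theorem volume_bandOver_ne_zero {l : ℕ} {C : Set (Fin m → ℝ)} (hC0 : volume C ≠ 0)
    (ξ : Fin l → (Fin m → ℝ) → ℝ) (hmono : ∀ x ∈ C, StrictMono fun i => ξ i x) (j : Fin (l + 1))
    (hBm : MeasurableSet (bandOver C ξ j)) : volume (bandOver C ξ j) ≠ 0 := by
  intro h0
  rw [Grounding.volume_eq_lintegral_fibre hBm,
    lintegral_eq_zero_iff' (measurable_volume_fibre hBm).aemeasurable] at h0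
  -- the fibres over `C` have positive length, so `C` is null
  have hpos : ∀ x ∈ C, volume (FibreLength.fibre (bandOver C ξ j) x) ≠ 0 := by
    intro x hx
    have hfib : FibreLength.fibre (bandOver C ξ j) x =
        ((↑) : ℝ → EReal) ⁻¹' Ioo (bandLower ξ j x) (bandUpper ξ j x) := by
      ext t
      simp [FibreLength.fibre, hx]
    have hopen : IsOpen (FibreLength.fibre (bandOver C ξ j) x) := by
      rw [hfib]
      exact isOpen_Ioo.preimage continuous_coe_real_ereal
    obtain ⟨q, hq1, hq2⟩ := EReal.exists_rat_btwn_of_lt (bandLower_lt_bandUpper ξ (hmono x hx) j)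
    have hne : (FibreLength.fibre (bandOver C ξ j) x).Nonempty := ⟨q, by rw [hfib]; exact ⟨hq1, hq2⟩⟩
    exact (hopen.measure_pos volume hne).ne'
  have hCnull : volume C = 0 := by
    refine measure_mono_null (fun x hx => ?_) (ae_iff.1 h0)
    exact hpos x hx
  exact hC0 hCnull

/-- The vertical lines over the two ends of the strip are null (each is a coordinate hyperplane of
`ℝ²`, `Measure.pi_hyperplane`). [folklore] -/
theorem volume_setOf_apply_zero_eq_or (a₀ a₁ : ℝ) :
    volume {z : Fin 2 → ℝ | z 0 = a₀ ∨ z 0 = a₁} = 0 := by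
  have hline : ∀ c : ℝ, volume {z : Fin 2 → ℝ | z 0 = c} = 0 := fun c => by
    rw [volume_pi]
    exact Measure.pi_hyperplane (fun _ : Fin 2 => (volume : Measure ℝ)) (0 : Fin 2) c
  have : {z : Fin 2 → ℝ | z 0 = a₀ ∨ z 0 = a₁} = {z | z 0 = a₀} ∪ {z | z 0 = a₁} := by
    ext z; simp
  rw [this]
  exact measure_union_null (hline a₀) (hline a₁)

/-- **The engine over one base cell.** Notation as in the module docstring: `r` is the band
representation, `r'` the base representation on the strip `(a₀, a₁)`, `U` the open band, `C` a cell of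
a cylindrical decomposition of `ℝ¹` with sections `ξ`, adapted to `U \ Z` (graphs `Gσ`, bands `Bσ`)
and to `U ∩ Z` (graphs `Gτ`, bands `Bτ`); `RC`, `RC'` are the pieces of `r`, `r'` over `C`. Then
`[RC] − [RC'] ∈ KZ.relations`. [cite: KontsevichZagier2001, §1.2 rules (1),(3)] -/
theorem stub_bandNLCell {a₀ a₁ : ℚ} {α β : ℝ → ℝ} {F : (Fin 2 → ℝ) → ℝ} {Z U : Set (Fin 2 → ℝ)}
    {r : KZ.IntegralRep 2} {r' : KZ.IntegralRep 1}
    (hdom : r.domain = {p : Fin 2 → ℝ | p 0 ∈ Icc (a₀ : ℝ) a₁ ∧ α (p 0) ≤ p 1 ∧ p 1 ≤ β (p 0)})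
    (hF : IsSemialgebraicFunOn ℚ r.domain F) (hM : ∃ M : ℝ, ∀ p ∈ r.domain, |F p| ≤ M)
    (hcont : ∀ t ∈ Ioo (a₀ : ℝ) a₁, ContinuousOn (fun s : ℝ => F ![t, s]) (Icc (α t) (β t)))
    (hderiv : ∀ p ∈ r.domain, p 0 ∈ Ioo (a₀ : ℝ) a₁ → α (p 0) < p 1 → p 1 < β (p 0) → p ∉ Z →
      HasDerivAt (fun s : ℝ => F ![p 0, s]) (r.integrand p) (p 1))
    (hα : IsSemialgebraicFunOn ℚ {z : Fin 1 → ℝ | z 0 ∈ Ioo (a₀ : ℝ) a₁} (fun z => α (z 0)))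
    (hβ : IsSemialgebraicFunOn ℚ {z : Fin 1 → ℝ | z 0 ∈ Ioo (a₀ : ℝ) a₁} (fun z => β (z 0)))
    (hαβ : ∀ t ∈ Ioo (a₀ : ℝ) a₁, α t ≤ β t)
    (hr'd : r'.domain = {z : Fin 1 → ℝ | z 0 ∈ Ioo (a₀ : ℝ) a₁})
    (hr'i : ∀ z ∈ r'.domain, r'.integrand z = F ![z 0, β (z 0)] - F ![z 0, α (z 0)])
    (hZ0 : volume Z = 0)
    (hU : U = {p : Fin 2 → ℝ | p 0 ∈ Ioo (a₀ : ℝ) a₁ ∧ α (p 0) < p 1 ∧ p 1 < β (p 0)})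
    {C : Set (Fin 1 → ℝ)} (hC : IsSemialgebraic ℚ C) {l : ℕ} {ξ : Fin l → (Fin 1 → ℝ) → ℝ}
    (hξ : ∀ i, IsSemialgebraicFunOn ℚ C (ξ i)) (hmono : ∀ x ∈ C, StrictMono fun i => ξ i x)
    (hbands : ∀ j, IsSemialgebraic ℚ (bandOver C ξ j))
    {Gσ Gτ : Finset (Fin l)} {Bσ Bτ : Finset (Fin (l + 1))}
    (hBσ : ∀ j ∈ Bσ, bandOver C ξ j ⊆ U \ Z)
    (hσfib : ∀ x ∈ C, {t : ℝ | (Fin.snoc x t : Fin 2 → ℝ) ∈ U \ Z} =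
      (⋃ j ∈ Gσ, {ξ j x}) ∪ ⋃ j ∈ Bσ, {t : ℝ | bandLower ξ j x < t ∧ (t : EReal) < bandUpper ξ j x})
    (hBτ : ∀ j ∈ Bτ, bandOver C ξ j ⊆ U ∩ Z)
    (hτfib : ∀ x ∈ C, {t : ℝ | (Fin.snoc x t : Fin 2 → ℝ) ∈ U ∩ Z} =
      (⋃ j ∈ Gτ, {ξ j x}) ∪ ⋃ j ∈ Bτ, {t : ℝ | bandLower ξ j x < t ∧ (t : EReal) < bandUpper ξ j x})
    (RC : KZ.IntegralRep 2) (hRCd : RC.domain = r.domain ∩ {z | Fin.init z ∈ C})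
    (hRCi : RC.integrand = r.integrand)
    (RC' : KZ.IntegralRep 1) (hRC'd : RC'.domain = r'.domain ∩ C) (hRC'i : RC'.integrand = r'.integrand) :
    KZ.of RC - KZ.of RC' ∈ KZ.relations := by
  classical
  have hs0 : ∀ (x : Fin 1 → ℝ) (t : ℝ), (Fin.snoc x t : Fin 2 → ℝ) 0 = x 0 := fun _ _ => rfl
  have hs1 : ∀ (x : Fin 1 → ℝ) (t : ℝ), (Fin.snoc x t : Fin 2 → ℝ) 1 = t := fun _ _ => rfl
  -- membership in `U` of a point written as `snoc x t`
  have hUsnoc : ∀ (x : Fin 1 → ℝ) (t : ℝ), (Fin.snoc x t : Fin 2 → ℝ) ∈ U ↔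
      x 0 ∈ Ioo (a₀ : ℝ) a₁ ∧ α (x 0) < t ∧ t < β (x 0) := by
    intro x t
    rw [hU, mem_setOf_eq, hs0, hs1]
  by_cases hC0 : volume C = 0
  · -- both pieces are null
    refine KZ.relations.sub_mem (KZ.of_mem_relations_of_volume_eq_zero RC ?_)
      (KZ.of_mem_relations_of_volume_eq_zero RC' ?_)
    · rw [hRCd]
      exact measure_mono_null inter_subset_right (KZ.volume_setOf_init_mem_eq_zero (n := 1) hC0)
    · rw [hRC'd]
      exact measure_mono_null inter_subset_right hC0
  -- a cell of positive measure
  have hCne : C.Nonempty := nonempty_of_measure_ne_zero hC0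
  -- (1) `Z` has no bands over `C`
  have hBτe : ∀ j ∈ Bτ, False := fun j hj =>
    volume_bandOver_ne_zero hC0 ξ hmono j
      (Literature.ModelTheory.ExponentialFields.IsSemialgebraic.measurableSet_holds (hbands j))
      (measure_mono_null ((hBτ j hj).trans inter_subset_right) hZ0)
  -- (2) the bands of `U \ Z` over `C` are inner
  have hinner : ∀ j ∈ Bσ, j ≠ 0 ∧ j ≠ Fin.last l := by
    intro j hj
    obtain ⟨x, hx⟩ := hCne
    by_contra hcon
    have hj' : j = 0 ∨ j = Fin.last l := by tauto
    have htop := KZ.volume_bandFibre_eq_top ξ hj' x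
    have hsub : {t : ℝ | bandLower ξ j x < t ∧ (t : EReal) < bandUpper ξ j x} ⊆
        Ioo (α (x 0)) (β (x 0)) := by
      intro t ht
      have hmem : (Fin.snoc x t : Fin 2 → ℝ) ∈ U :=
        ((hBσ j hj) (snoc_mem_bandOver_iff.2 ⟨hx, ht.1, ht.2⟩)).1
      rw [hUsnoc] at hmem
      exact ⟨hmem.2.1, hmem.2.2⟩
    have hle := measure_mono (μ := volume) hsub
    rw [htop, Real.volume_Ioo, top_le_iff] at hle
    exact ENNReal.ofReal_ne_top hle
  -- the finite boundaries of the inner bands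
  set lo : Fin (l + 1) → (Fin 1 → ℝ) → ℝ := fun j x => (bandLower ξ j x).toReal with hlo_def
  set hi : Fin (l + 1) → (Fin 1 → ℝ) → ℝ := fun j x => (bandUpper ξ j x).toReal with hhi_def
  have hlo : ∀ j (h0 : j ≠ 0) x, lo j x = ξ (j.pred h0) x := fun j h0 x => by
    simp only [hlo_def, bandLower_of_ne_zero ξ j h0, EReal.toReal_coe]
  have hhi : ∀ j (hl : j ≠ Fin.last l) x, hi j x = ξ (j.castPred hl) x := fun j hl x => by
    simp only [hhi_def, bandUpper_of_ne_last ξ j hl, EReal.toReal_coe]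
  have hlosa : ∀ j ∈ Bσ, IsSemialgebraicFunOn ℚ C (lo j) := fun j hj =>
    (hξ (j.pred (hinner j hj).1)).congr fun x _ => (hlo j _ x).symm
  have hhisa : ∀ j ∈ Bσ, IsSemialgebraicFunOn ℚ C (hi j) := fun j hj =>
    (hξ (j.castPred (hinner j hj).2)).congr fun x _ => (hhi j _ x).symm
  have hlt : ∀ j ∈ Bσ, ∀ x ∈ C, lo j x < hi j x := fun j hj x hx =>
    KZ.toReal_bandLower_lt_toReal_bandUpper ξ (hmono x hx) (hinner j hj).1 (hinner j hj).2
  -- the open fibre of an inner band is `(lo, hi)`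
  have hfibIoo : ∀ j ∈ Bσ, ∀ x, {t : ℝ | bandLower ξ j x < t ∧ (t : EReal) < bandUpper ξ j x} =
      Ioo (lo j x) (hi j x) := fun j hj x =>
    KZ.bandFibre_eq_Ioo ξ (hinner j hj).1 (hinner j hj).2 x
  -- points of the open sub-bands lie in `U \ Z`
  have hguardU : ∀ j ∈ Bσ, ∀ x ∈ C, ∀ t ∈ Ioo (lo j x) (hi j x),
      (Fin.snoc x t : Fin 2 → ℝ) ∈ U \ Z := by
    intro j hj x hx t ht
    have ht' : t ∈ {t : ℝ | bandLower ξ j x < t ∧ (t : EReal) < bandUpper ξ j x} := by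
      rw [hfibIoo j hj x]; exact ht
    exact (hBσ j hj) (snoc_mem_bandOver_iff.2 ⟨hx, ht'.1, ht'.2⟩)
  have hguard : ∀ j ∈ Bσ, ∀ x ∈ C, ∀ t ∈ Ioo (lo j x) (hi j x),
      (α (x 0) < t ∧ t < β (x 0)) ∧ (Fin.snoc x t : Fin 2 → ℝ) ∉ Z := by
    intro j hj x hx t ht
    have h := hguardU j hj x hx t ht
    have hU' := h.1
    rw [hUsnoc] at hU'
    exact ⟨hU'.2, h.2⟩
  -- over a point of `C` under a band of `U \ Z`: the base point is in the strip and `α < β` there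
  have hstripOf : ∀ j ∈ Bσ, ∀ x ∈ C, x 0 ∈ Ioo (a₀ : ℝ) a₁ ∧ α (x 0) < β (x 0) := by
    intro j hj x hx
    obtain ⟨t, ht1, ht2⟩ := exists_between (hlt j hj x hx)
    have h := (hguardU j hj x hx t ⟨ht1, ht2⟩).1
    rw [hUsnoc] at h
    exact ⟨h.1, h.2.1.trans h.2.2⟩
  have hCstrip : ∀ j ∈ Bσ, C ⊆ {x : Fin 1 → ℝ | x 0 ∈ Ioo (a₀ : ℝ) a₁} := fun j hj x hx =>
    (hstripOf j hj x hx).1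
  -- (3) the fibre of `U` over a strip point of `C`: finitely many section values and the `σ`-bands
  have hUfib : ∀ x ∈ C, x 0 ∈ Ioo (a₀ : ℝ) a₁ → Ioo (α (x 0)) (β (x 0)) =
      ((⋃ j ∈ Gσ, {ξ j x}) ∪ ⋃ j ∈ Gτ, {ξ j x}) ∪
        ⋃ j ∈ Bσ, {t : ℝ | bandLower ξ j x < t ∧ (t : EReal) < bandUpper ξ j x} := by
    intro x hx hx0
    have hσ := hσfib x hx
    have hτ := hτfib x hx
    ext t
    have hmemU : t ∈ Ioo (α (x 0)) (β (x 0)) ↔ (Fin.snoc x t : Fin 2 → ℝ) ∈ U := by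
      rw [hUsnoc]
      exact ⟨fun h => ⟨hx0, h.1, h.2⟩, fun h => ⟨h.2.1, h.2.2⟩⟩
    rw [hmemU]
    constructor
    · intro htU
      by_cases htZ : (Fin.snoc x t : Fin 2 → ℝ) ∈ Z
      · have ht : t ∈ {t : ℝ | (Fin.snoc x t : Fin 2 → ℝ) ∈ U ∩ Z} := ⟨htU, htZ⟩
        rw [hτ] at ht
        rcases ht with ht | ht
        · exact Or.inl (Or.inr ht)
        · simp only [mem_iUnion, exists_prop] at ht
          obtain ⟨j, hj, -⟩ := ht
          exact (hBτe j hj).elim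
      · have ht : t ∈ {t : ℝ | (Fin.snoc x t : Fin 2 → ℝ) ∈ U \ Z} := ⟨htU, htZ⟩
        rw [hσ] at ht
        rcases ht with ht | ht
        · exact Or.inl (Or.inl ht)
        · exact Or.inr ht
    · rintro ((ht | ht) | ht)
      · have ht' : t ∈ {t : ℝ | (Fin.snoc x t : Fin 2 → ℝ) ∈ U \ Z} := by rw [hσ]; exact Or.inl ht
        exact ht'.1
      · have ht' : t ∈ {t : ℝ | (Fin.snoc x t : Fin 2 → ℝ) ∈ U ∩ Z} := by rw [hτ]; exact Or.inl ht
        exact ht'.1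
      · have ht' : t ∈ {t : ℝ | (Fin.snoc x t : Fin 2 → ℝ) ∈ U \ Z} := by rw [hσ]; exact Or.inr ht
        exact ht'.1
  have hEfin : ∀ x, (((⋃ j ∈ Gσ, {ξ j x}) ∪ ⋃ j ∈ Gτ, {ξ j x}) : Set ℝ).Finite := fun x =>
    (Gσ.finite_toSet.biUnion fun j _ => finite_singleton (ξ j x)).union
      (Gτ.finite_toSet.biUnion fun j _ => finite_singleton (ξ j x))
  -- (4) one Newton–Leibniz move per sub-band
  have hsub : ∀ j : {j // j ∈ Bσ}, ∃ (Bd : KZ.IntegralRep 2) (b : KZ.IntegralRep 1),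
      Bd.domain = KZlog.band C (lo j) (hi j) ∧ Bd.domain ⊆ r.domain ∧ Bd.integrand = r.integrand ∧
      b.domain = C ∧ (b.integrand = fun x => F (Fin.snoc x (hi j x)) - F (Fin.snoc x (lo j x))) ∧
      KZ.of Bd - KZ.of b ∈ KZ.newtonLeibnizRel := fun j =>
    stub_subband a₀ a₁ α β F Z r hdom hF hM hcont hderiv hC (hCstrip j j.2) (hlosa j j.2)
      (hhisa j j.2) (hlt j j.2) (hguard j j.2)
  choose Bd b hBdd hBdr hBdi hbd hbi hNL using hsub
  -- (5) rule 1a: the piece of the band over `C` is the sum of the closed sub-bands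
  have e1 : KZ.of RC - ∑ j ∈ Bσ.attach, KZ.of (Bd j) ∈ KZ.relations := by
    refine KZ.of_sub_sum_of_mem_relations Bσ.attach RC Bd (fun j _ => ?_) (fun j _ z _ => ?_) ?_ ?_
    · rw [show (Bd j).domain \ RC.domain = ∅ from sdiff_eq_empty.mpr fun z hz => ?_, measure_empty]
      rw [hRCd]
      refine ⟨hBdr j hz, ?_⟩
      rw [hBdd] at hz
      exact (KZlog.mem_band.1 hz).1
    · rw [hBdi, hRCi]
    · -- the complement is covered by two vertical lines and finitely many graphs
      have hN : volume ({z : Fin 2 → ℝ | z 0 = a₀ ∨ z 0 = a₁} ∪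
          ({z : Fin 2 → ℝ | Fin.init z ∈ {x : Fin 1 → ℝ | x 0 ∈ Ioo (a₀ : ℝ) a₁} ∧
              z (Fin.last 1) = α ((Fin.init z) 0)} ∪
            {z : Fin 2 → ℝ | Fin.init z ∈ {x : Fin 1 → ℝ | x 0 ∈ Ioo (a₀ : ℝ) a₁} ∧
              z (Fin.last 1) = β ((Fin.init z) 0)}) ∪
          ⋃ j ∈ Gσ ∪ Gτ, {z : Fin 2 → ℝ | Fin.init z ∈ C ∧ z (Fin.last 1) = ξ j (Fin.init z)}) = 0 := by
        refine measure_union_null (measure_union_null (volume_setOf_apply_zero_eq_or _ _)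
          (measure_union_null (KZ.volume_graph_eq_zero hα) (KZ.volume_graph_eq_zero hβ))) ?_
        exact (measure_biUnion_null_iff (Gσ ∪ Gτ).countable_toSet).2 fun j _ =>
          KZ.volume_graph_eq_zero (hξ j)
      refine measure_mono_null (fun z hz => ?_) hN
      obtain ⟨hzR, hzU⟩ := hz
      rw [hRCd, hdom] at hzR
      obtain ⟨⟨hz0, hz1, hz2⟩, hzC⟩ := hzR
      have hzC : Fin.init z ∈ C := hzC
      simp only [mem_union, mem_setOf_eq, mem_iUnion, exists_prop, Finset.mem_union]
      rcases hz0.1.eq_or_lt with h0 | h0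
      · exact Or.inl (Or.inl (Or.inl h0.symm))
      rcases hz0.2.eq_or_lt with h1 | h1
      · exact Or.inl (Or.inl (Or.inr h1))
      have hx0 : z 0 ∈ Ioo (a₀ : ℝ) a₁ := ⟨h0, h1⟩
      rcases hz1.eq_or_lt with h2 | h2
      · exact Or.inl (Or.inr (Or.inl ⟨hx0, h2.symm⟩))
      rcases hz2.eq_or_lt with h3 | h3
      · exact Or.inl (Or.inr (Or.inr ⟨hx0, h3⟩))
      -- an interior point: read it on the fibre of `U` over `init z`
      have ht : z (Fin.last 1) ∈ Ioo (α ((Fin.init z) 0)) (β ((Fin.init z) 0)) := ⟨h2, h3⟩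
      rw [hUfib _ hzC hx0] at ht
      simp only [mem_union, mem_iUnion, mem_singleton_iff, exists_prop] at ht
      rcases ht with (⟨j, hj, hjt⟩ | ⟨j, hj, hjt⟩) | ⟨j, hj, hjt⟩
      · exact Or.inr ⟨j, Or.inl hj, hzC, hjt⟩
      · exact Or.inr ⟨j, Or.inr hj, hzC, hjt⟩
      · -- inside an open `σ`-band, hence inside a closed sub-band: excluded
        rw [hfibIoo j hj] at hjt
        refine absurd (mem_iUnion₂.2 ⟨⟨j, hj⟩, Finset.mem_attach _ _, ?_⟩) hzU
        rw [hBdd, ← Fin.snoc_init_self z]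
        exact KZlog.snoc_mem_band.2 ⟨hzC, hjt.1.le, hjt.2.le⟩
    · -- two closed sub-bands meet in a graph
      intro j _ j' _ hne
      have hne' : (j : Fin (l + 1)) ≠ j' := fun h => hne (Subtype.ext h)
      have key : ∀ i i' : {j // j ∈ Bσ}, (i : Fin (l + 1)) < i' →
          (Bd i).domain ∩ (Bd i').domain ⊆
            {z : Fin 2 → ℝ | Fin.init z ∈ C ∧ z (Fin.last 1) = hi i (Fin.init z)} := by
        intro i i' hii' z hz
        rw [hBdd, hBdd] at hz
        obtain ⟨⟨hzC, -, h2⟩, ⟨-, h3, -⟩⟩ := KZlog.mem_band.1 hz.1, KZlog.mem_band.1 hz.2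
        have hle : hi i (Fin.init z) ≤ lo i' (Fin.init z) := by
          have h := KZ.bandUpper_le_bandLower_of_lt ξ (hmono _ hzC) hii'
          rw [bandUpper_of_ne_last ξ _ (hinner _ i.2).2, bandLower_of_ne_zero ξ _ (hinner _ i'.2).1,
            EReal.coe_le_coe_iff] at h
          rwa [hhi _ (hinner _ i.2).2, hlo _ (hinner _ i'.2).1]
        exact ⟨hzC, le_antisymm h2 (hle.trans h3)⟩
      rcases lt_or_gt_of_ne hne' with h | h
      · exact measure_mono_null (key j j' h) (KZ.volume_graph_eq_zero (hhisa j j.2))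
      · rw [inter_comm]
        exact measure_mono_null (key j' j h) (KZ.volume_graph_eq_zero (hhisa j' j'.2))
  -- (6) rule 3 on every sub-band
  have eNL : ∑ j ∈ Bσ.attach, KZ.of (Bd j) - ∑ j ∈ Bσ.attach, KZ.of (b j) ∈ KZ.relations :=
    KZ.sum_sub_sum_mem_relations _ _ _ fun j _ => KZ.newtonLeibnizRel_subset_relations (hNL j)
  -- (7) rule 1b: the base integrands telescope to `F(x, β x) − F(x, α x)`
  have eb : KZ.of RC' - ∑ j ∈ Bσ.attach, KZ.of (b j) ∈ KZ.relations := by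
    by_cases hBe : Bσ = ∅
    · subst hBe
      rw [Finset.attach_empty, Finset.sum_empty, sub_zero]
      refine KZ.of_mem_relations_of_eqOn_zero RC' fun x hx => ?_
      rw [hRC'd, hr'd] at hx
      obtain ⟨hx0, hxC⟩ := hx
      have hx0 : x 0 ∈ Ioo (a₀ : ℝ) a₁ := hx0
      have heq : α (x 0) = β (x 0) := by
        by_contra hne
        have hlt' : α (x 0) < β (x 0) := lt_of_le_of_ne (hαβ _ hx0) hne
        have hfin : (Ioo (α (x 0)) (β (x 0))).Finite := by
          rw [hUfib x hxC hx0]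
          simp only [Finset.notMem_empty, iUnion_of_empty, iUnion_empty, union_empty]
          exact hEfin x
        exact (Set.Ioo_infinite hlt') hfin
      show RC'.integrand x = 0
      rw [hRC'i, hr'i x (by rw [hr'd]; exact hx0), heq, sub_self]
    · obtain ⟨j₀, hj₀⟩ := Finset.nonempty_iff_ne_empty.2 hBe
      have hCs := hCstrip j₀ hj₀
      have hdomC : RC'.domain = C := by
        rw [hRC'd, hr'd]
        exact inter_eq_right.2 hCs
      refine KZ.of_sub_sum_integrand_mem_relations Bσ.attach b RC' (fun j _ => by rw [hbd, hdomC])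
        fun x hx => ?_
      rw [hdomC] at hx
      obtain ⟨hx0, hαβx⟩ := hstripOf j₀ hj₀ x hx
      have htel := stub_telescope ξ x (hmono x hx) Bσ hinner (α (x 0)) (β (x 0)) hαβx _ (hEfin x)
        (hUfib x hx hx0) (fun t => F (Fin.snoc x t))
      have hg : ∀ t, F (Fin.snoc x t) = F ![x 0, t] := fun t =>
        congrFun (subband_fibreFun_eq F x) t
      show RC'.integrand x = ∑ j ∈ Bσ.attach, (b j).integrand x
      simp_rw [hbi]
      rw [Finset.sum_attach Bσ fun j => F (Fin.snoc x (hi j x)) - F (Fin.snoc x (lo j x)), htel,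
        hRC'i, hr'i x (by rw [hr'd]; exact hx0), hg, hg]
  -- assembly
  have : KZ.of RC - KZ.of RC' = (KZ.of RC - ∑ j ∈ Bσ.attach, KZ.of (Bd j)) +
      (∑ j ∈ Bσ.attach, KZ.of (Bd j) - ∑ j ∈ Bσ.attach, KZ.of (b j)) -
      (KZ.of RC' - ∑ j ∈ Bσ.attach, KZ.of (b j)) := by abel
  rw [this]
  exact KZ.relations.sub_mem (KZ.relations.add_mem e1 eNL) eb

end Summit.KontsevichZagierPeriods.IsogenyCertificates.GenusTwoRealPeriodCellLine

end
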